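import Literature.NumberTheory.GaloisRepresentations.LubinTateColemanRelativeSeriesTwo
import HarnessLib

/-!
# Galois equivariance of the relative Coleman power series: `g_{σβ} = g_β ∘ [κ(σ)]_f` (de Shalit I Cor. 2.3 (iv), unramified base, `q = 2`)

De Shalit, *Iwasawa theory of elliptic curves with complex multiplication* (1987), Ch. I §2.3 (iv): for `σ ∈ Gal(k_ξ/k')` with
`σ(ω) = [κ(σ)]_f(ω)`, `g_{σ(β)} = g_β ∘ [κ(σ)]_f`.  Over the unramified base `E ⊆ F^{nr}` (finite Galois over `F`), `f = πX + X²`,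
with `σ = relRestrict σ̃` the restriction of an element `σ̃ ∈ Γ_F` FIXING `E` pointwise and `κ(σ) = χ_π(σ̃)` (`lubinTateChar`),
this file PROVES (0 sorry):

* `homE` — the endomorphism `[v]_f` read in `𝒪_E⟦X⟧`; `evS_homE_map` (`[v]_f(y) = [v] y` at points), `map_homE`,
  `map_iterate_subst_homE` (the twists `(φ⁻¹)^{k}` commute with `∘ [v]_f`), `evS_subst_homE` (`(G ∘ [v])^ι(y) = G^ι([v]y)`).
* ★★ `relColemanSeries_eq_subst_homE` — **if `β'_m = σ(β_m)` for all `m` (`σ = σ̃|_{E·K_π^{m+1}}`, `σ̃|_E = id`) then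
  `g_{β'} = g_β ∘ [χ_π(σ̃)]_f`**.

## References

* E. de Shalit, *Iwasawa theory of elliptic curves with complex multiplication* (1987), Ch. I §2.3 Corollary (iv). [deShalit1987]
-/

noncomputable section

open Filter Topology
open scoped PowerSeries.WithPiTopology

namespace Literature.NumberTheory.GaloisRepresentations

section RelativeGaloisTwo

open GaloisRepresentations.IsNonarchimedeanLocalField LubinTate ValuativeRel Field

variable {F : Type} [Field F] [ValuativeRel F] [TopologicalSpace F] [IsNonarchimedeanLocalField F]

attribute [local instance] ltNormUniformSpace ltNormIsUniformAddGroup rk1 nF nE fintypeResidueField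

variable {π : 𝒪[F]} (hπ : (valuation F).IsUniformizer (π : F))
variable (E : IntermediateField F (AlgebraicClosure F)) [FiniteDimensional F E]

/-! ### `[v]_f` read in `𝒪_E⟦X⟧` -/

/-- **`[v]_f ∈ 𝒪_E⟦X⟧`**: the Lubin–Tate endomorphism series with its `𝒪_F`-coefficients read in `𝒪_E`.
[cite: deShalit1987, Ch. I §1.5] -/
def homE (v : 𝒪[F]) : PowerSeries (unitBall E) :=
  (hom (isLTRing_LTCoeff hπ) (isLTSeries_LTCoeff π) (isLTSeries_LTCoeff π) (LTCoeff.of F v)).map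
    (algebraMap (LTCoeff F) (unitBall E))

/-- `[v]_f(0) = 0` in `𝒪_E⟦X⟧`. [cite: deShalit1987, Ch. I §1.5] -/
theorem constantCoeff_homE (v : 𝒪[F]) : PowerSeries.constantCoeff (homE hπ E v) = 0 := by
  rw [homE, ← PowerSeries.coeff_zero_eq_constantCoeff_apply, PowerSeries.coeff_map, PowerSeries.coeff_zero_eq_constantCoeff_apply,
    constantCoeff_hom, map_zero]

/-- **`[v]_f(y) = [v] y`** at a point `y` of `𝔪_E`. [cite: deShalit1987, Ch. I §1.5] -/
theorem evS_homE (v : 𝒪[F]) (y : (maxNilIdeal F E).toIdeal) :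
    evS (maxNilIdeal F E) y (homE hπ E v) =
      ((ltSMul (maxNilIdeal F E) (isLTRing_LTCoeff hπ) (isLTSeries_LTCoeff π) (LTCoeff.of F v) y :
        (maxNilIdeal F E).toIdeal) : unitBall E) := by
  rw [homE, evS_map]; rfl

variable {E} in
/-- A ring map over `𝒪_F` fixes `[v]_f`: `([v]_f)^ψ = [v]_f` (`ψ ∘ ι_{E₁} = ι_{E₂}`). [cite: deShalit1987, Ch. I §1.5] -/
theorem map_homE {E₂ : IntermediateField F (AlgebraicClosure F)} [FiniteDimensional F E₂] {ψ : unitBall E →+* unitBall E₂}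
    (hψ : ∀ a : LTCoeff F, ψ (algebraMap (LTCoeff F) (unitBall E) a) = algebraMap (LTCoeff F) (unitBall E₂) a) (v : 𝒪[F]) :
    PowerSeries.map ψ (homE hπ E v) = homE hπ E₂ v := by
  have hcomp : ψ.comp (algebraMap (LTCoeff F) (unitBall E)) = algebraMap (LTCoeff F) (unitBall E₂) := RingHom.ext hψ
  rw [homE, homE, ← RingHom.comp_apply (PowerSeries.map ψ) (PowerSeries.map _), ← PowerSeries.map_comp, hcomp]

variable {E} in
/-- `(G ∘ [v]_f)^ψ = G^ψ ∘ [v]_f` for `ψ` over `𝒪_F`. [cite: deShalit1987, Ch. I §2.3 (iv)] -/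
theorem map_subst_homE {E₂ : IntermediateField F (AlgebraicClosure F)} [FiniteDimensional F E₂] {ψ : unitBall E →+* unitBall E₂}
    (hψ : ∀ a : LTCoeff F, ψ (algebraMap (LTCoeff F) (unitBall E) a) = algebraMap (LTCoeff F) (unitBall E₂) a)
    (v : 𝒪[F]) (G : PowerSeries (unitBall E)) :
    PowerSeries.map ψ (G.subst (homE hπ E v)) = (PowerSeries.map ψ G).subst (homE hπ E₂ v) := by
  have e : PowerSeries.map ψ (G.subst (homE hπ E v)) = (PowerSeries.map ψ G).subst ((homE hπ E v).map ψ) :=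
    PowerSeries.map_subst (PowerSeries.HasSubst.of_constantCoeff_zero' (constantCoeff_homE hπ E v)) G
  rw [e, map_homE hπ hψ]

/-- The twists `ψ^k` commute with `∘ [v]_f`. [cite: deShalit1987, Ch. I §2.3 (iv)] -/
theorem map_iterate_subst_homE {ψ : unitBall E →+* unitBall E}
    (hψ : ∀ a : LTCoeff F, ψ (algebraMap (LTCoeff F) (unitBall E) a) = algebraMap (LTCoeff F) (unitBall E) a)
    (v : 𝒪[F]) (k : ℕ) (G : PowerSeries (unitBall E)) :
    (PowerSeries.map ψ)^[k] (G.subst (homE hπ E v)) = ((PowerSeries.map ψ)^[k] G).subst (homE hπ E v) := by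
  induction k generalizing G with
  | zero => rfl
  | succ k ih => rw [Function.iterate_succ_apply, Function.iterate_succ_apply, map_subst_homE hπ hψ, ih]

variable {E} in
/-- **`(G ∘ [v]_f)^ι(y) = G^ι([v] y)`** (`E ≤ E'`, `y ∈ 𝔪_{E'}`). [cite: deShalit1987, Ch. I §2.3 (iv)] -/
theorem evS_map_subst_homE {E' : IntermediateField F (AlgebraicClosure F)} [FiniteDimensional F E'] (h : E ≤ E') (v : 𝒪[F])
    (G : PowerSeries (unitBall E)) (y : (maxNilIdeal F E').toIdeal) :
    evS (maxNilIdeal F E') y (PowerSeries.map (inclUnitBall (F := F) h : unitBall E →+* unitBall E') (G.subst (homE hπ E v))) =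
      evS (maxNilIdeal F E') (ltSMul (maxNilIdeal F E') (isLTRing_LTCoeff hπ) (isLTSeries_LTCoeff π) (LTCoeff.of F v) y)
        (PowerSeries.map (inclUnitBall (F := F) h : unitBall E →+* unitBall E') G) := by
  rw [map_subst_homE hπ (ψ := (inclUnitBall (F := F) h : unitBall E →+* unitBall E')) (fun a => (inclUnitBall (F := F) h).commutes a),
    evS_subst (maxNilIdeal F E') y (constantCoeff_homE hπ E' v)]
  congr 2
  apply Subtype.ext
  exact evS_homE hπ E' v y

/-! ### `g_{σβ} = g_β ∘ [χ(σ̃)]_f` -/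

variable [Normal F E] [IsGalois F E] (hq : residueFieldCard F = 2) (hE : E ≤ maxUnramified F)
  {σ₀ : absoluteGaloisGroup F} (hσ₀ : IsAbsArithFrob σ₀)

/-- ★★ **Galois equivariance of the relative Coleman series** (de Shalit Cor. I.2.3 (iv) over the unramified base):
if `σ̃ ∈ Γ_F` fixes `E` pointwise and `β'_m = σ̃|_{E·K_π^{m+1}}(β_m)` for all `m`, then `g_{β'} = g_β ∘ [χ_π(σ̃)]_f`
(the values agree: `((φ⁻¹)^{m+1}(g_β ∘ [v]))^ι(ω_{m+1}) = ((φ⁻¹)^{m+1}g_β)^ι([v]ω_{m+1}) = σ(β_m)`, and uniqueness).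
[cite: deShalit1987, Ch. I §2.3 (iv)] -/
theorem relColemanSeries_eq_subst_homE (β β' : RelNormCoherentUnits hπ E) {σ : absoluteGaloisGroup F}
    (hσE : ∀ x : E, σ • (x : AlgebraicClosure F) = x)
    (hβ' : ∀ m, ((β'.val m : unitBall (E ⊔ ltField π m : IntermediateField F (AlgebraicClosure F))) :
        (E ⊔ ltField π m : IntermediateField F (AlgebraicClosure F))) =
      relRestrict hπ E m σ ((β.val m : unitBall (E ⊔ ltField π m : IntermediateField F (AlgebraicClosure F))) :
        (E ⊔ ltField π m : IntermediateField F (AlgebraicClosure F)))) :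
    relColemanSeries hπ E hq hE hσ₀ β' =
      (relColemanSeries hπ E hq hE hσ₀ β).subst (homE hπ E (lubinTateChar hπ σ : 𝒪[F])) := by
  symm
  refine eq_relColemanSeries hπ E hq hE hσ₀ fun m => ?_
  have hψ : ∀ a : LTCoeff F, ((frobUnitBall E σ₀).symm : unitBall E →+* unitBall E) (algebraMap (LTCoeff F) (unitBall E) a) =
      algebraMap (LTCoeff F) (unitBall E) a := fun a => by
    change (frobUnitBall E σ₀).symm (algebraMap 𝒪[F] (unitBall E) ((LTCoeff.of F).symm a)) = _
    rw [RingEquiv.symm_apply_eq]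
    exact (unitBallEquiv_algebraMap E _ _).symm
  rw [map_iterate_subst_homE hπ E hψ, evS_map_subst_homE hπ (le_sup_left : E ≤ E ⊔ ltField π m)]
  -- `[χ(σ̃)] ω_{m+1} = σ ω_{m+1}`
  have hpt : ltSMul (maxNilIdeal F (E ⊔ ltField π m : IntermediateField F (AlgebraicClosure F))) (isLTRing_LTCoeff hπ)
      (isLTSeries_LTCoeff π) (LTCoeff.of F (lubinTateChar hπ σ : 𝒪[F]))
      (inclPt (le_sup_right : ltField π m ≤ E ⊔ ltField π m) (cohPt hπ m)) =
      mapPt (relRestrict hπ E m σ) (inclPt (le_sup_right : ltField π m ≤ E ⊔ ltField π m) (cohPt hπ m)) := by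
    rw [inclPt_cohPt_eq_relAct, mapPt_relRestrict_relAct, ← relAct, ← relAct_mul]
  rw [hpt, ← Subtype.coe_inj]
  rw [← algEquiv_evS_map_inclUnitBall (le_sup_left : E ≤ E ⊔ ltField π m) (relRestrict hπ E m σ)
    (relRestrict_apply_inclusion hπ E m hσE) _ _, evS_relColemanSeries, hβ']

end RelativeGaloisTwo

end Literature.NumberTheory.GaloisRepresentations
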